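import Summits.AtomisticToContinuum.FouriersLaw.Theorems.VanishingNoiseTransferNoisyFourierThomsonWitnessCostsLiouvillianAux2
import Summits.AtomisticToContinuum.FouriersLaw.Theorems.VanishingNoiseTransferNoisyFourierThomsonWitnessMomentsAux1
import Summits.AtomisticToContinuum.FouriersLaw.Theorems.VanishingNoiseTransferNoisyFourierThomsonWitnessPattern

/-!
# Costs of the Thomson witness, Liouvillian part, III: `X v ∈ L²(μ_T)`, `∫ (X v)² ≤ c (L − 1)`, `∫ (P₀ X v)² = 4T²`
(`--supports` file for crux `VanishingNoiseTransfer.NoisyFourier`, stmt-AtomisticToContinuum-11977, line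
`abel-storage-decay`, stub B `stub_bulkAbelGKPositivity`; part W5b "WitnessL2Liouvillian" of lead c7's
Thomson-witness project, file 3 of 3)

Setting: `P = pinnedChain ω₂ lam β γ` (`ω₂, lam, β, γ, T > 0`), `μ_T = P.gibbsMeasure L T`, `X = P.liouvillian L`,
`v` the Thomson witness (shared text, written inline), `P₀` the momentum sign-pattern average. By part W3
(`…ThomsonWitnessPattern`) `X v = h₀ + Σ_i f^A_i + Σ_j f^B_j` with `h₀ = p_0² − p_{L−1}²` and the site-indexed bond
functions of file II (`…CostsLiouvillianAux2`), and `P₀ (X v) = h₀`.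
* `exists_fA_abs_le`, `memLp_fA`, `exists_integral_fA_sq_le` (+ `B` versions): `f^A_i ∈ L²(μ_T)` with
  `∫ (f^A_i)² ≤ C` UNIFORMLY in `L` and `i` (pointwise bound by the local size, uniform moments of file II);
* `exists_integral_sq_sum_fA_le` (+ `B`): `∫ (Σ_i f^A_i)² ≤ 5 C L` by the banded Gram bound of part W2
  (`integral_sq_sum_le_of_banded_parity`, band width `2`: `f^A_i` is `F_i`-odd and `F_m`-even for `|m − i| > 2`);
* `memLp_liouvillian_thomsonWitness` (L1), `integral_sq_patternAvg_liouvillian_thomsonWitness` (L2: `= 4T²`, part W4),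
  `exists_integral_sq_liouvillian_thomsonWitness_le` (L3: `∫ (X v)² ≤ c (L − 1)` for all `L ≥ 2`), and the registered
  wrapper `helper_thomsonWitnessCostsLiouvillian` (L4) delivering conjuncts 2, 7, 8 of the lead's `witness_costs`.
All statements are [folklore]; no definitions; axioms `propext`, `Classical.choice`, `Quot.sound` only.
-/

noncomputable section

open MeasureTheory
open scoped BigOperators
open Literature.MathematicalPhysics.KineticTheory.HeatConduction
open Summit.AtomisticToContinuum.FouriersLaw.Theorems.ChainVariation (pinnedChain_abs_momentum_pow_le_all)
open Summit.AtomisticToContinuum.FouriersLaw.Cruxes.SuperadditiveResistance.InsertionToolbox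
  (pinnedChain_memLp_two_of_abs_le)
open Summit.AtomisticToContinuum.FouriersLaw.Theorems.NoisyFourier.ThomsonWitness.Moments (integral_sq_sub_sq_sq)
open Summit.AtomisticToContinuum.FouriersLaw.Theorems.NoisyFourier.ThomsonWitness.Parity
  (integral_sq_sum_le_of_banded_parity)
open Summit.AtomisticToContinuum.FouriersLaw.Theorems.NoisyFourier.ThomsonWitness.Algebra
  (ite_add_zero_eq liouvillian_thomsonWitness patternAvg_liouvillian_thomsonWitness)
open Summit.AtomisticToContinuum.FouriersLaw.Theorems.NoisyFourier.ThomsonWitness.Costs.Xv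

namespace Summit.AtomisticToContinuum.FouriersLaw.Theorems.NoisyFourier.ThomsonWitness.Costs

variable {ω₂ lam β : ℝ}

/-- `(a + (b + c))² ≤ 3(a² + (b² + c²))`. [folklore] -/
theorem add_add_sq_le (a b c : ℝ) : (a + (b + c)) ^ 2 ≤ 3 * (a ^ 2 + (b ^ 2 + c ^ 2)) := by
  nlinarith [sq_nonneg (a - b), sq_nonneg (b - c), sq_nonneg (a - c)]

/-- Regrouping the bond double sum by sites: `Σ_i Σ_{j=i+1} (p_i R_A + p_j R_B) = Σ_i f^A_i + Σ_j f^B_j`. [folklore] -/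
theorem sum_bond_split {L : ℕ} (γ : ℝ) (x : PhaseSpace L) :
    (∑ i : Fin L, ∑ j : Fin L, if j.val = i.val + 1 then
      (x.2 i * (x.2 j * (x.2 j ^ 2 * (6 * β * (9 * β * (x.1 j - x.1 i) ^ 2 - 1) / (1 + 3 * β * (x.1 j - x.1 i) ^ 2) ^ 3) - partialQ j (partialQ j ((pinnedChain ω₂ lam β γ).hamiltonian L)) x * (1 / (1 + 3 * β * (x.1 j - x.1 i) ^ 2)) - 3 * partialQ j ((pinnedChain ω₂ lam β γ).hamiltonian L) x * (-(6 * β * (x.1 j - x.1 i)) / (1 + 3 * β * (x.1 j - x.1 i) ^ 2) ^ 2)) + (∑ k : Fin L, if k.val = j.val + 1 then x.2 k * (1 + 3 * β * (x.1 k - x.1 j) ^ 2) else 0) * (1 / (1 + 3 * β * (x.1 j - x.1 i) ^ 2))) +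
        x.2 j * (x.2 i * (-(x.2 i ^ 2 * (6 * β * (9 * β * (x.1 j - x.1 i) ^ 2 - 1) / (1 + 3 * β * (x.1 j - x.1 i) ^ 2) ^ 3)) + partialQ i (partialQ i ((pinnedChain ω₂ lam β γ).hamiltonian L)) x * (1 / (1 + 3 * β * (x.1 j - x.1 i) ^ 2)) - 3 * partialQ i ((pinnedChain ω₂ lam β γ).hamiltonian L) x * (-(6 * β * (x.1 j - x.1 i)) / (1 + 3 * β * (x.1 j - x.1 i) ^ 2) ^ 2)) - (∑ k : Fin L, if i.val = k.val + 1 then x.2 k * (1 + 3 * β * (x.1 i - x.1 k) ^ 2) else 0) * (1 / (1 + 3 * β * (x.1 j - x.1 i) ^ 2))))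
      else 0) =
      (∑ i : Fin L, (∑ j : Fin L, if j.val = i.val + 1 then x.2 i * (x.2 j * (x.2 j ^ 2 * (6 * β * (9 * β * (x.1 j - x.1 i) ^ 2 - 1) / (1 + 3 * β * (x.1 j - x.1 i) ^ 2) ^ 3) - partialQ j (partialQ j ((pinnedChain ω₂ lam β γ).hamiltonian L)) x * (1 / (1 + 3 * β * (x.1 j - x.1 i) ^ 2)) - 3 * partialQ j ((pinnedChain ω₂ lam β γ).hamiltonian L) x * (-(6 * β * (x.1 j - x.1 i)) / (1 + 3 * β * (x.1 j - x.1 i) ^ 2) ^ 2)) + (∑ k : Fin L, if k.val = j.val + 1 then x.2 k * (1 + 3 * β * (x.1 k - x.1 j) ^ 2) else 0) * (1 / (1 + 3 * β * (x.1 j - x.1 i) ^ 2))) else 0)) +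
        ∑ j : Fin L, (∑ i : Fin L, if j.val = i.val + 1 then x.2 j * (x.2 i * (-(x.2 i ^ 2 * (6 * β * (9 * β * (x.1 j - x.1 i) ^ 2 - 1) / (1 + 3 * β * (x.1 j - x.1 i) ^ 2) ^ 3)) + partialQ i (partialQ i ((pinnedChain ω₂ lam β γ).hamiltonian L)) x * (1 / (1 + 3 * β * (x.1 j - x.1 i) ^ 2)) - 3 * partialQ i ((pinnedChain ω₂ lam β γ).hamiltonian L) x * (-(6 * β * (x.1 j - x.1 i)) / (1 + 3 * β * (x.1 j - x.1 i) ^ 2) ^ 2)) - (∑ k : Fin L, if i.val = k.val + 1 then x.2 k * (1 + 3 * β * (x.1 i - x.1 k) ^ 2) else 0) * (1 / (1 + 3 * β * (x.1 j - x.1 i) ^ 2))) else 0) := by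
  simp only [ite_add_zero_eq, Finset.sum_add_distrib]
  congr 1
  exact Finset.sum_comm

section Gibbs

variable (hω : 0 < ω₂) (hl : 0 ≤ lam) (hβ : 0 ≤ β) (γ : ℝ) {T : ℝ} (hT : 0 < T)
include hω hl hβ hT

/-! ### The bond functions are in `L²(μ_T)`, with uniformly bounded second moments -/

omit hT in
/-- `|f^A_i| ≤ C (1 + H)^5` with `C` uniform in `L`, `i`. [folklore] -/
theorem exists_fA_abs_le : ∃ C : ℝ, ∀ (L : ℕ) (i : Fin L) (x : PhaseSpace L),
    |(∑ j : Fin L, if j.val = i.val + 1 then x.2 i * (x.2 j * (x.2 j ^ 2 * (6 * β * (9 * β * (x.1 j - x.1 i) ^ 2 - 1) / (1 + 3 * β * (x.1 j - x.1 i) ^ 2) ^ 3) - partialQ j (partialQ j ((pinnedChain ω₂ lam β γ).hamiltonian L)) x * (1 / (1 + 3 * β * (x.1 j - x.1 i) ^ 2)) - 3 * partialQ j ((pinnedChain ω₂ lam β γ).hamiltonian L) x * (-(6 * β * (x.1 j - x.1 i)) / (1 + 3 * β * (x.1 j - x.1 i) ^ 2) ^ 2)) + (∑ k : Fin L, if k.val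 = j.val + 1 then x.2 k * (1 + 3 * β * (x.1 k - x.1 j) ^ 2) else 0) * (1 / (1 + 3 * β * (x.1 j - x.1 i) ^ 2))) else 0)| ≤
      C * (1 + (pinnedChain ω₂ lam β γ).hamiltonian L x) ^ 5 := by
  obtain ⟨K, hK0, hK⟩ := fA_sq_le ω₂ lam γ hβ
  refine ⟨(1 + K * (3 + 2 * ω₂⁻¹) ^ 5) / 2, fun L i x => ?_⟩
  have hH := pinnedChain_hamiltonian_nonneg hω.le hl hβ γ L x
  have h1 := hK L i x
  have h2 := pow_le_pow_left₀ (by linarith [one_le_localSize i x]) (localSize_le (γ := γ) hω hl hβ i x) 5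
  rw [mul_pow] at h2
  have h3 := h1.trans (mul_le_mul_of_nonneg_left h2 hK0)
  have h4 : (1 : ℝ) ≤ (1 + (pinnedChain ω₂ lam β γ).hamiltonian L x) ^ 5 := one_le_pow₀ (by linarith)
  have h5 : ∀ f : ℝ, |f| ≤ (1 + f ^ 2) / 2 := fun f => by nlinarith [sq_nonneg (|f| - 1), sq_abs f, abs_nonneg f]
  have h6 := h5 (∑ j : Fin L, if j.val = i.val + 1 then x.2 i * (x.2 j * (x.2 j ^ 2 * (6 * β * (9 * β * (x.1 j - x.1 i) ^ 2 - 1) / (1 + 3 * β * (x.1 j - x.1 i) ^ 2) ^ 3) - partialQ j (partialQ j ((pinnedChain ω₂ lam β γ).hamiltonian L)) x * (1 / (1 + 3 * β * (x.1 j - x.1 i) ^ 2)) - 3 * partialQ j ((pinnedChain ω₂ lam β γ).hamiltonian L) x * (-(6 * β * (x.1 j - x.1 i)) / (1 + 3 * β * (x.1 j - x.1 i) ^ 2) ^ 2)) + (∑ k : Fin L, if k.val = j.val + 1 then x.2 k * (1 + 3 * β * (x.1 k - x.1 j) ^ 2) else 0) * (1 / (1 + 3 * β * (x.1 j - x.1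 i) ^ 2))) else 0)
  have hK5 : 0 ≤ K * (3 + 2 * ω₂⁻¹) ^ 5 := by positivity
  nlinarith

omit hT in
/-- `|f^B_j| ≤ C (1 + H)^5` with `C` uniform in `L`, `j`. [folklore] -/
theorem exists_fB_abs_le : ∃ C : ℝ, ∀ (L : ℕ) (j : Fin L) (x : PhaseSpace L),
    |(∑ i : Fin L, if j.val = i.val + 1 then x.2 j * (x.2 i * (-(x.2 i ^ 2 * (6 * β * (9 * β * (x.1 j - x.1 i) ^ 2 - 1) / (1 + 3 * β * (x.1 j - x.1 i) ^ 2) ^ 3)) + partialQ i (partialQ i ((pinnedChain ω₂ lam β γ).hamiltonian L)) x * (1 / (1 + 3 * β * (x.1 j - x.1 i) ^ 2)) - 3 * partialQ i ((pinnedChain ω₂ lam β γ).hamiltonian L) x * (-(6 * β * (x.1 j - x.1 i)) / (1 + 3 * β * (x.1 j - x.1 i) ^ 2) ^ 2)) - (∑ k : Fin L, if i.val = k.val + 1 then x.2 k * (1 + 3 * β * (x.1 i - x.1 k) ^ 2) else 0) * (1 / (1 + 3 * β * (x.1 j - x.1 i) ^ 2))) else 0)| ≤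
      C * (1 + (pinnedChain ω₂ lam β γ).hamiltonian L x) ^ 5 := by
  obtain ⟨K, hK0, hK⟩ := fB_sq_le ω₂ lam γ hβ
  refine ⟨(1 + K * (3 + 2 * ω₂⁻¹) ^ 5) / 2, fun L j x => ?_⟩
  have hH := pinnedChain_hamiltonian_nonneg hω.le hl hβ γ L x
  have h1 := hK L j x
  have h2 := pow_le_pow_left₀ (by linarith [one_le_localSize j x]) (localSize_le (γ := γ) hω hl hβ j x) 5
  rw [mul_pow] at h2
  have h3 := h1.trans (mul_le_mul_of_nonneg_left h2 hK0)
  have h4 : (1 : ℝ) ≤ (1 + (pinnedChain ω₂ lam β γ).hamiltonian L x) ^ 5 := one_le_pow₀ (by linarith)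
  have h5 : ∀ f : ℝ, |f| ≤ (1 + f ^ 2) / 2 := fun f => by nlinarith [sq_nonneg (|f| - 1), sq_abs f, abs_nonneg f]
  have h6 := h5 (∑ i : Fin L, if j.val = i.val + 1 then x.2 j * (x.2 i * (-(x.2 i ^ 2 * (6 * β * (9 * β * (x.1 j - x.1 i) ^ 2 - 1) / (1 + 3 * β * (x.1 j - x.1 i) ^ 2) ^ 3)) + partialQ i (partialQ i ((pinnedChain ω₂ lam β γ).hamiltonian L)) x * (1 / (1 + 3 * β * (x.1 j - x.1 i) ^ 2)) - 3 * partialQ i ((pinnedChain ω₂ lam β γ).hamiltonian L) x * (-(6 * β * (x.1 j - x.1 i)) / (1 + 3 * β * (x.1 j - x.1 i) ^ 2) ^ 2)) - (∑ k : Fin L, if i.val = k.val + 1 then x.2 k * (1 + 3 * β * (x.1 i - x.1 k) ^ 2) else 0) * (1 / (1 + 3 * β * (x.1 j - x.1 i) ^ 2))) else 0)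
  have hK5 : 0 ≤ K * (3 + 2 * ω₂⁻¹) ^ 5 := by positivity
  nlinarith

/-- `f^A_i ∈ L²(μ_T)`. [folklore] -/
theorem memLp_fA (L : ℕ) (i : Fin L) :
    MemLp (fun x : PhaseSpace L => (∑ j : Fin L, if j.val = i.val + 1 then x.2 i * (x.2 j * (x.2 j ^ 2 * (6 * β * (9 * β * (x.1 j - x.1 i) ^ 2 - 1) / (1 + 3 * β * (x.1 j - x.1 i) ^ 2) ^ 3) - partialQ j (partialQ j ((pinnedChain ω₂ lam β γ).hamiltonian L)) x * (1 / (1 + 3 * β * (x.1 j - x.1 i) ^ 2)) - 3 * partialQ j ((pinnedChain ω₂ lam β γ).hamiltonian L) x * (-(6 * β * (x.1 j - x.1 i)) / (1 + 3 * β * (x.1 j - x.1 i) ^ 2) ^ 2)) + (∑ k : Fin L, if k.val = j.val + 1 then x.2 k * (1 + 3 * β * (x.1 k - x.1 j) ^ 2) else 0) * (1 / (1 + 3 * β * (x.1 j - x.1 i) ^ 2))) else 0)) 2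
      ((pinnedChain ω₂ lam β γ).gibbsMeasure L T) := by
  obtain ⟨C, hC⟩ := exists_fA_abs_le hω hl hβ γ
  exact pinnedChain_memLp_two_of_abs_le hω hl hβ γ L hT (continuous_fA hβ i) (hC L i)

/-- `f^B_j ∈ L²(μ_T)`. [folklore] -/
theorem memLp_fB (L : ℕ) (j : Fin L) :
    MemLp (fun x : PhaseSpace L => (∑ i : Fin L, if j.val = i.val + 1 then x.2 j * (x.2 i * (-(x.2 i ^ 2 * (6 * β * (9 * β * (x.1 j - x.1 i) ^ 2 - 1) / (1 + 3 * β * (x.1 j - x.1 i) ^ 2) ^ 3)) + partialQ i (partialQ i ((pinnedChain ω₂ lam β γ).hamiltonian L)) x * (1 / (1 + 3 * β * (x.1 j - x.1 i) ^ 2)) - 3 * partialQ i ((pinnedChain ω₂ lam β γ).hamiltonian L) x * (-(6 * β * (x.1 j - x.1 i)) / (1 + 3 * β * (x.1 j - x.1 i) ^ 2) ^ 2)) - (∑ k : Fin L, if i.val = k.val + 1 then x.2 k * (1 + 3 * β * (x.1 i - x.1 k) ^ 2) else 0) * (1 / (1 + 3 * β * (x.1 j - x.1 i) ^ 2))) else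 0)) 2
      ((pinnedChain ω₂ lam β γ).gibbsMeasure L T) := by
  obtain ⟨C, hC⟩ := exists_fB_abs_le hω hl hβ γ
  exact pinnedChain_memLp_two_of_abs_le hω hl hβ γ L hT (continuous_fB hβ j) (hC L j)

/-- **`∫ (f^A_i)² dμ_T ≤ C` uniformly in `L`, `i`.** [folklore] -/
theorem exists_integral_fA_sq_le : ∃ C : ℝ, 0 ≤ C ∧ ∀ (L : ℕ) (i : Fin L),
    ∫ x, (∑ j : Fin L, if j.val = i.val + 1 then x.2 i * (x.2 j * (x.2 j ^ 2 * (6 * β * (9 * β * (x.1 j - x.1 i) ^ 2 - 1) / (1 + 3 * β * (x.1 j - x.1 i) ^ 2) ^ 3) - partialQ j (partialQ j ((pinnedChain ω₂ lam β γ).hamiltonian L)) x * (1 / (1 + 3 * β * (x.1 j - x.1 i) ^ 2)) - 3 * partialQ j ((pinnedChain ω₂ lam β γ).hamiltonian L) x * (-(6 * β * (x.1 j - x.1 i)) / (1 + 3 * β * (x.1 j - x.1 i) ^ 2) ^ 2)) + (∑ k : Fin L, if k.val = j.val + 1 then x.2 k * (1 + 3 * β * (x.1 k - x.1 j) ^ 2)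 else 0) * (1 / (1 + 3 * β * (x.1 j - x.1 i) ^ 2))) else 0) ^ 2
      ∂((pinnedChain ω₂ lam β γ).gibbsMeasure L T) ≤ C := by
  obtain ⟨K, hK0, hK⟩ := fA_sq_le ω₂ lam γ hβ
  obtain ⟨C5, hC5⟩ := exists_integral_localSize_pow_le hω hl hβ γ hT 5
  refine ⟨max (K * C5) 0, le_max_right _ _, fun L i => le_trans ?_ (le_max_left _ _)⟩
  obtain ⟨hint, hle⟩ := hC5 L i
  calc ∫ x, (∑ j : Fin L, if j.val = i.val + 1 then x.2 i * (x.2 j * (x.2 j ^ 2 * (6 * β * (9 * β * (x.1 j - x.1 i) ^ 2 - 1) / (1 + 3 * β * (x.1 j - x.1 i) ^ 2) ^ 3) - partialQ j (partialQ j ((pinnedChain ω₂ lam β γ).hamiltonian L)) x * (1 / (1 + 3 * β * (x.1 j - x.1 i) ^ 2)) - 3 * partialQ j ((pinnedChain ω₂ lam β γ).hamiltonian L) x * (-(6 * β * (x.1 j - x.1 i)) / (1 + 3 * β * (x.1 j - x.1 i) ^ 2) ^ 2)) + (∑ k : Fin L, if k.val = j.val + 1 then x.2 k * (1 + 3 *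 β * (x.1 k - x.1 j) ^ 2) else 0) * (1 / (1 + 3 * β * (x.1 j - x.1 i) ^ 2))) else 0) ^ 2 ∂((pinnedChain ω₂ lam β γ).gibbsMeasure L T)
      ≤ ∫ x, K * (1 + ∑ k ∈ Finset.univ.filter (fun k : Fin L => i.val ≤ k.val + 2 ∧ k.val ≤ i.val + 2), (x.2 k ^ 2 + x.1 k ^ 2)) ^ 5 ∂((pinnedChain ω₂ lam β γ).gibbsMeasure L T) :=
        integral_mono_of_nonneg (ae_of_all _ fun x => sq_nonneg _) (hint.const_mul K) (ae_of_all _ fun x => hK L i x)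
    _ = K * ∫ x, (1 + ∑ k ∈ Finset.univ.filter (fun k : Fin L => i.val ≤ k.val + 2 ∧ k.val ≤ i.val + 2), (x.2 k ^ 2 + x.1 k ^ 2)) ^ 5 ∂((pinnedChain ω₂ lam β γ).gibbsMeasure L T) := integral_const_mul _ _
    _ ≤ K * C5 := mul_le_mul_of_nonneg_left hle hK0

/-- **`∫ (f^B_j)² dμ_T ≤ C` uniformly in `L`, `j`.** [folklore] -/
theorem exists_integral_fB_sq_le : ∃ C : ℝ, 0 ≤ C ∧ ∀ (L : ℕ) (j : Fin L),
    ∫ x, (∑ i : Fin L, if j.val = i.val + 1 then x.2 j * (x.2 i * (-(x.2 i ^ 2 * (6 * β * (9 * β * (x.1 j - x.1 i) ^ 2 - 1) / (1 + 3 * β * (x.1 j - x.1 i) ^ 2) ^ 3)) + partialQ i (partialQ i ((pinnedChain ω₂ lam β γ).hamiltonian L)) x * (1 / (1 + 3 * β * (x.1 j - x.1 i) ^ 2)) - 3 * partialQ i ((pinnedChain ω₂ lam β γ).hamiltonian L) x * (-(6 * β * (x.1 j - x.1 i)) / (1 + 3 * β * (x.1 j - x.1 i) ^ 2) ^ 2))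 - (∑ k : Fin L, if i.val = k.val + 1 then x.2 k * (1 + 3 * β * (x.1 i - x.1 k) ^ 2) else 0) * (1 / (1 + 3 * β * (x.1 j - x.1 i) ^ 2))) else 0) ^ 2
      ∂((pinnedChain ω₂ lam β γ).gibbsMeasure L T) ≤ C := by
  obtain ⟨K, hK0, hK⟩ := fB_sq_le ω₂ lam γ hβ
  obtain ⟨C5, hC5⟩ := exists_integral_localSize_pow_le hω hl hβ γ hT 5
  refine ⟨max (K * C5) 0, le_max_right _ _, fun L j => le_trans ?_ (le_max_left _ _)⟩
  obtain ⟨hint, hle⟩ := hC5 L j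
  calc ∫ x, (∑ i : Fin L, if j.val = i.val + 1 then x.2 j * (x.2 i * (-(x.2 i ^ 2 * (6 * β * (9 * β * (x.1 j - x.1 i) ^ 2 - 1) / (1 + 3 * β * (x.1 j - x.1 i) ^ 2) ^ 3)) + partialQ i (partialQ i ((pinnedChain ω₂ lam β γ).hamiltonian L)) x * (1 / (1 + 3 * β * (x.1 j - x.1 i) ^ 2)) - 3 * partialQ i ((pinnedChain ω₂ lam β γ).hamiltonian L) x * (-(6 * β * (x.1 j - x.1 i)) / (1 + 3 * β * (x.1 j - x.1 i) ^ 2) ^ 2)) - (∑ k : Fin L, if i.val = k.val + 1 then x.2 k * (1 + 3 * β * (x.1 i - x.1 k) ^ 2) else 0) * (1 / (1 + 3 * β * (x.1 j - x.1 i) ^ 2))) else 0) ^ 2 ∂((pinnedChain ω₂ lam β γ).gibbsMeasure L T)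
      ≤ ∫ x, K * (1 + ∑ k ∈ Finset.univ.filter (fun k : Fin L => j.val ≤ k.val + 2 ∧ k.val ≤ j.val + 2), (x.2 k ^ 2 + x.1 k ^ 2)) ^ 5 ∂((pinnedChain ω₂ lam β γ).gibbsMeasure L T) :=
        integral_mono_of_nonneg (ae_of_all _ fun x => sq_nonneg _) (hint.const_mul K) (ae_of_all _ fun x => hK L j x)
    _ = K * ∫ x, (1 + ∑ k ∈ Finset.univ.filter (fun k : Fin L => j.val ≤ k.val + 2 ∧ k.val ≤ j.val + 2), (x.2 k ^ 2 + x.1 k ^ 2)) ^ 5 ∂((pinnedChain ω₂ lam β γ).gibbsMeasure L T) := integral_const_mul _ _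
    _ ≤ K * C5 := mul_le_mul_of_nonneg_left hle hK0

/-! ### The banded Gram bound for the two site sums -/

/-- **`∫ (Σ_i f^A_i)² dμ_T ≤ C L`**: `f^A_i` is `F_i`-odd and `F_m`-even for `|m − i| > 2`, so the banded Gram bound
of part W2 with band width `2` applies. [folklore] -/
theorem exists_integral_sq_sum_fA_le : ∃ C : ℝ, 0 ≤ C ∧ ∀ (L : ℕ),
    ∫ x, (∑ i : Fin L, (∑ j : Fin L, if j.val = i.val + 1 then x.2 i * (x.2 j * (x.2 j ^ 2 * (6 * β * (9 * β * (x.1 j - x.1 i) ^ 2 - 1) / (1 + 3 * β * (x.1 j - x.1 i) ^ 2) ^ 3) - partialQ j (partialQ j ((pinnedChain ω₂ lam β γ).hamiltonian L)) x * (1 / (1 + 3 * β * (x.1 j - x.1 i) ^ 2)) - 3 * partialQ j ((pinnedChain ω₂ lam β γ).hamiltonian L) x * (-(6 * β * (x.1 j - x.1 i)) / (1 + 3 * β * (x.1 j - x.1 i) ^ 2) ^ 2)) + (∑ k : Fin L, if k.val = j.val + 1 then x.2 k * (1 + 3 * β * (x.1 k - x.1 j) ^ 2) else 0) * (1 / (1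 + 3 * β * (x.1 j - x.1 i) ^ 2))) else 0)) ^ 2
      ∂((pinnedChain ω₂ lam β γ).gibbsMeasure L T) ≤ C * L := by
  obtain ⟨C, hC0, hC⟩ := exists_integral_fA_sq_le hω hl hβ γ hT
  refine ⟨5 * C, by positivity, fun L => ?_⟩
  have h := integral_sq_sum_le_of_banded_parity
    (fun m => (pinnedChain ω₂ lam β γ).measurePreserving_momentumFlip_gibbsMeasure L T m)
    (fun (i : Fin L) (x : PhaseSpace L) => (∑ j : Fin L, if j.val = i.val + 1 then x.2 i * (x.2 j * (x.2 j ^ 2 * (6 * β * (9 * β * (x.1 j - x.1 i) ^ 2 - 1) / (1 + 3 * β * (x.1 j - x.1 i) ^ 2) ^ 3) - partialQ j (partialQ j ((pinnedChain ω₂ lam β γ).hamiltonian L)) x * (1 / (1 + 3 * β * (x.1 j - x.1 i) ^ 2)) - 3 * partialQ j ((pinnedChain ω₂ lam β γ).hamiltonian L) x * (-(6 * β * (x.1 j - x.1 i)) / (1 + 3 * β * (x.1 j - x.1 i) ^ 2) ^ 2)) + (∑ k : Fin L, if k.val = j.val + 1 then x.2 k * (1 + 3 * β * (x.1 k - x.1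 j) ^ 2) else 0) * (1 / (1 + 3 * β * (x.1 j - x.1 i) ^ 2))) else 0)) 2
    (fun i => memLp_fA hω hl hβ γ hT L i) (fun i x => fA_momentumFlip_self i x)
    (fun m i hmi x => fA_momentumFlip_of_ne (fun e => by rw [e] at hmi; omega) (by omega) (by omega) x)
  refine h.trans ?_
  calc (2 * ((2 : ℕ) : ℝ) + 1) * ∑ i : Fin L, ∫ x, (∑ j : Fin L, if j.val = i.val + 1 then x.2 i * (x.2 j * (x.2 j ^ 2 * (6 * β * (9 * β * (x.1 j - x.1 i) ^ 2 - 1) / (1 + 3 * β * (x.1 j - x.1 i) ^ 2) ^ 3) - partialQ j (partialQ j ((pinnedChain ω₂ lam β γ).hamiltonian L)) x * (1 / (1 + 3 * β * (x.1 j - x.1 i) ^ 2)) - 3 * partialQ j ((pinnedChain ω₂ lam β γ).hamiltonian L) x * (-(6 * β * (x.1 j - x.1 i)) / (1 + 3 * β * (x.1 j - x.1 i) ^ 2) ^ 2)) + (∑ k : Fin L, if k.val = j.val + 1 then x.2 k * (1 + 3 * β * (x.1 k - x.1 j) ^ 2) else 0) * (1 / (1 + 3 * β * (x.1 j - x.1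 i) ^ 2))) else 0) ^ 2
        ∂((pinnedChain ω₂ lam β γ).gibbsMeasure L T)
      ≤ (2 * ((2 : ℕ) : ℝ) + 1) * ∑ _i : Fin L, C := by
        gcongr with i
        exact hC L i
    _ = 5 * C * L := by
        rw [Finset.sum_const, Finset.card_univ, Fintype.card_fin, nsmul_eq_mul]
        push_cast
        ring

/-- **`∫ (Σ_j f^B_j)² dμ_T ≤ C L`** (band width `2` again). [folklore] -/
theorem exists_integral_sq_sum_fB_le : ∃ C : ℝ, 0 ≤ C ∧ ∀ (L : ℕ),
    ∫ x, (∑ j : Fin L, (∑ i : Fin L, if j.val = i.val + 1 then x.2 j * (x.2 i * (-(x.2 i ^ 2 * (6 * β * (9 * β * (x.1 j - x.1 i) ^ 2 - 1) / (1 + 3 * β * (x.1 j - x.1 i) ^ 2) ^ 3)) + partialQ i (partialQ i ((pinnedChain ω₂ lam β γ).hamiltonian L)) x * (1 / (1 + 3 * β * (x.1 j - x.1 i) ^ 2)) - 3 * partialQ i ((pinnedChain ω₂ lam β γ).hamiltonian L) x * (-(6 * β * (x.1 j - x.1 i)) / (1 + 3 * β * (x.1 j - x.1 i) ^ 2) ^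 2)) - (∑ k : Fin L, if i.val = k.val + 1 then x.2 k * (1 + 3 * β * (x.1 i - x.1 k) ^ 2) else 0) * (1 / (1 + 3 * β * (x.1 j - x.1 i) ^ 2))) else 0)) ^ 2
      ∂((pinnedChain ω₂ lam β γ).gibbsMeasure L T) ≤ C * L := by
  obtain ⟨C, hC0, hC⟩ := exists_integral_fB_sq_le hω hl hβ γ hT
  refine ⟨5 * C, by positivity, fun L => ?_⟩
  have h := integral_sq_sum_le_of_banded_parity
    (fun m => (pinnedChain ω₂ lam β γ).measurePreserving_momentumFlip_gibbsMeasure L T m)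
    (fun (j : Fin L) (x : PhaseSpace L) => (∑ i : Fin L, if j.val = i.val + 1 then x.2 j * (x.2 i * (-(x.2 i ^ 2 * (6 * β * (9 * β * (x.1 j - x.1 i) ^ 2 - 1) / (1 + 3 * β * (x.1 j - x.1 i) ^ 2) ^ 3)) + partialQ i (partialQ i ((pinnedChain ω₂ lam β γ).hamiltonian L)) x * (1 / (1 + 3 * β * (x.1 j - x.1 i) ^ 2)) - 3 * partialQ i ((pinnedChain ω₂ lam β γ).hamiltonian L) x * (-(6 * β * (x.1 j - x.1 i)) / (1 + 3 * β * (x.1 j - x.1 i) ^ 2) ^ 2)) - (∑ k : Fin L, if i.val = k.val + 1 then x.2 k * (1 + 3 * β * (x.1 i - x.1 k) ^ 2) else 0) * (1 / (1 + 3 * β * (x.1 j - x.1 i) ^ 2))) else 0)) 2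
    (fun j => memLp_fB hω hl hβ γ hT L j) (fun j x => fB_momentumFlip_self j x)
    (fun m j hmj x => fB_momentumFlip_of_ne (fun e => by rw [e] at hmj; omega) (by omega) (by omega) x)
  refine h.trans ?_
  calc (2 * ((2 : ℕ) : ℝ) + 1) * ∑ j : Fin L, ∫ x, (∑ i : Fin L, if j.val = i.val + 1 then x.2 j * (x.2 i * (-(x.2 i ^ 2 * (6 * β * (9 * β * (x.1 j - x.1 i) ^ 2 - 1) / (1 + 3 * β * (x.1 j - x.1 i) ^ 2) ^ 3)) + partialQ i (partialQ i ((pinnedChain ω₂ lam β γ).hamiltonian L)) x * (1 / (1 + 3 * β * (x.1 j - x.1 i) ^ 2)) - 3 * partialQ i ((pinnedChain ω₂ lam β γ).hamiltonian L) x * (-(6 * β * (x.1 j - x.1 i)) / (1 + 3 * β * (x.1 j - x.1 i) ^ 2) ^ 2)) - (∑ k : Fin L, if i.val = k.val + 1 then x.2 k * (1 + 3 * β * (x.1 i - x.1 k) ^ 2) else 0) * (1 / (1 + 3 * β * (x.1 j - x.1 i) ^ 2))) else 0) ^ 2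
        ∂((pinnedChain ω₂ lam β γ).gibbsMeasure L T)
      ≤ (2 * ((2 : ℕ) : ℝ) + 1) * ∑ _j : Fin L, C := by
        gcongr with j
        exact hC L j
    _ = 5 * C * L := by
        rw [Finset.sum_const, Finset.card_univ, Fintype.card_fin, nsmul_eq_mul]
        push_cast
        ring

/-! ### The bath term `h₀ = p_0² − p_{L−1}²` -/

/-- `h₀ ∈ L²(μ_T)`. [folklore] -/
theorem memLp_h0 (L : ℕ) (i0 iL : Fin L) :
    MemLp (fun x : PhaseSpace L => x.2 i0 ^ 2 - x.2 iL ^ 2) 2 ((pinnedChain ω₂ lam β γ).gibbsMeasure L T) :=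
  pinnedChain_memLp_two_of_abs_le hω hl hβ γ L hT (by fun_prop) (C := 2 ^ 2 + 2 ^ 2) (k := 2) fun x => by
    have h1 := pinnedChain_abs_momentum_pow_le_all hω hl hβ γ L x i0 2
    have h2 := pinnedChain_abs_momentum_pow_le_all hω hl hβ γ L x iL 2
    calc |x.2 i0 ^ 2 - x.2 iL ^ 2| ≤ |x.2 i0 ^ 2| + |x.2 iL ^ 2| := abs_sub _ _
      _ ≤ _ := by linarith

/-! ### L1–L3: the Liouvillian of the Thomson witness -/

/-- **(L1) `X v ∈ L²(μ_T)`** for the Thomson witness `v` (`L ≥ 2`). [folklore] -/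
theorem memLp_liouvillian_thomsonWitness {L : ℕ} (hL : 2 ≤ L) :
    MemLp ((pinnedChain ω₂ lam β γ).liouvillian L (fun y : PhaseSpace L => ∑ i : Fin L, ∑ j : Fin L, if j.val = i.val + 1 then
      (y.2 i * (y.2 j ^ 2 * (-(6 * β * (y.1 j - y.1 i)) / (1 + 3 * β * (y.1 j - y.1 i) ^ 2) ^ 2) -
          partialQ j ((pinnedChain ω₂ lam β γ).hamiltonian L) y * (1 / (1 + 3 * β * (y.1 j - y.1 i) ^ 2))) +
        y.2 j * (y.2 i ^ 2 * (-(6 * β * (y.1 j - y.1 i)) / (1 + 3 * β * (y.1 j - y.1 i) ^ 2) ^ 2) +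
          partialQ i ((pinnedChain ω₂ lam β γ).hamiltonian L) y * (1 / (1 + 3 * β * (y.1 j - y.1 i) ^ 2))))
      else 0)) 2 ((pinnedChain ω₂ lam β γ).gibbsMeasure L T) := by
  have hfun : (pinnedChain ω₂ lam β γ).liouvillian L (fun y : PhaseSpace L => ∑ i : Fin L, ∑ j : Fin L, if j.val = i.val + 1 then
      (y.2 i * (y.2 j ^ 2 * (-(6 * β * (y.1 j - y.1 i)) / (1 + 3 * β * (y.1 j - y.1 i) ^ 2) ^ 2) -
          partialQ j ((pinnedChain ω₂ lam β γ).hamiltonian L) y * (1 / (1 + 3 * β * (y.1 j - y.1 i) ^ 2))) +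
        y.2 j * (y.2 i ^ 2 * (-(6 * β * (y.1 j - y.1 i)) / (1 + 3 * β * (y.1 j - y.1 i) ^ 2) ^ 2) +
          partialQ i ((pinnedChain ω₂ lam β γ).hamiltonian L) y * (1 / (1 + 3 * β * (y.1 j - y.1 i) ^ 2))))
      else 0) = fun x =>
      (x.2 ⟨0, by omega⟩ ^ 2 - x.2 ⟨L - 1, by omega⟩ ^ 2) +
      ((∑ i : Fin L, (∑ j : Fin L, if j.val = i.val + 1 then x.2 i * (x.2 j * (x.2 j ^ 2 * (6 * β * (9 * β * (x.1 j - x.1 i) ^ 2 - 1) / (1 + 3 * β * (x.1 j - x.1 i) ^ 2) ^ 3) - partialQ j (partialQ j ((pinnedChain ω₂ lam β γ).hamiltonian L)) x * (1 / (1 + 3 * β * (x.1 j - x.1 i) ^ 2)) - 3 * partialQ j ((pinnedChain ω₂ lam β γ).hamiltonian L) x * (-(6 * β * (x.1 j - x.1 i)) / (1 + 3 * β * (x.1 j - x.1 i) ^ 2) ^ 2)) + (∑ k : Fin L, if k.val = j.val + 1 then x.2 k * (1 + 3 * β * (x.1 k - x.1 j) ^ 2) else 0) * (1 / (1 + 3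 * β * (x.1 j - x.1 i) ^ 2))) else 0)) +
        ∑ j : Fin L, (∑ i : Fin L, if j.val = i.val + 1 then x.2 j * (x.2 i * (-(x.2 i ^ 2 * (6 * β * (9 * β * (x.1 j - x.1 i) ^ 2 - 1) / (1 + 3 * β * (x.1 j - x.1 i) ^ 2) ^ 3)) + partialQ i (partialQ i ((pinnedChain ω₂ lam β γ).hamiltonian L)) x * (1 / (1 + 3 * β * (x.1 j - x.1 i) ^ 2)) - 3 * partialQ i ((pinnedChain ω₂ lam β γ).hamiltonian L) x * (-(6 * β * (x.1 j - x.1 i)) / (1 + 3 * β * (x.1 j - x.1 i) ^ 2) ^ 2)) - (∑ k : Fin L, if i.val = k.val + 1 then x.2 k * (1 + 3 * β * (x.1 i - x.1 k) ^ 2) else 0) * (1 / (1 + 3 * β * (x.1 j - x.1 i) ^ 2))) else 0)) := by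
    funext x
    rw [liouvillian_thomsonWitness hβ hL x, sum_bond_split]
  rw [hfun]
  exact (memLp_h0 hω hl hβ γ hT L _ _).add ((memLp_finsetSum _ fun i _ => memLp_fA hω hl hβ γ hT L i).add
    (memLp_finsetSum _ fun j _ => memLp_fB hω hl hβ γ hT L j))

/-- **(L2) the pattern-defect value `∫ (P₀ X v)² dμ_T = 4T²`** (`L ≥ 2`): `P₀ X v = p_0² − p_{L−1}²` (part W3) and
the Gaussian fourth moments (part W4). [folklore] -/
theorem integral_sq_patternAvg_liouvillian_thomsonWitness {L : ℕ} (hL : 2 ≤ L) :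
    ∫ x, ((∑ σ : Fin L → Bool, (pinnedChain ω₂ lam β γ).liouvillian L (fun y : PhaseSpace L => ∑ i : Fin L, ∑ j : Fin L, if j.val = i.val + 1 then
      (y.2 i * (y.2 j ^ 2 * (-(6 * β * (y.1 j - y.1 i)) / (1 + 3 * β * (y.1 j - y.1 i) ^ 2) ^ 2) -
          partialQ j ((pinnedChain ω₂ lam β γ).hamiltonian L) y * (1 / (1 + 3 * β * (y.1 j - y.1 i) ^ 2))) +
        y.2 j * (y.2 i ^ 2 * (-(6 * β * (y.1 j - y.1 i)) / (1 + 3 * β * (y.1 j - y.1 i) ^ 2) ^ 2) +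
          partialQ i ((pinnedChain ω₂ lam β γ).hamiltonian L) y * (1 / (1 + 3 * β * (y.1 j - y.1 i) ^ 2))))
      else 0)
      (x.1, fun i => if σ i then -x.2 i else x.2 i)) / 2 ^ L) ^ 2 ∂((pinnedChain ω₂ lam β γ).gibbsMeasure L T) = 4 * T ^ 2 := by
  simp_rw [patternAvg_liouvillian_thomsonWitness hβ hL]
  refine integral_sq_sub_sq_sq hω hl hβ γ hT L fun h => ?_
  have := congrArg Fin.val h
  simp only at this
  omega

/-- **(L3) `∫ (X v)² dμ_T ≤ c (L − 1)`** for every `L ≥ 2`, with `c = c(ω₂, lam, β, T)`: `(h₀ + S_A + S_B)² ≤ 3(h₀² +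
S_A² + S_B²)`, `∫ h₀² = 4T²`, and the banded Gram bounds `∫ S_A², ∫ S_B² ≤ C L`. [folklore] -/
theorem exists_integral_sq_liouvillian_thomsonWitness_le : ∃ c : ℝ, ∀ (L : ℕ), 2 ≤ L →
    ∫ x, ((pinnedChain ω₂ lam β γ).liouvillian L (fun y : PhaseSpace L => ∑ i : Fin L, ∑ j : Fin L, if j.val = i.val + 1 then
      (y.2 i * (y.2 j ^ 2 * (-(6 * β * (y.1 j - y.1 i)) / (1 + 3 * β * (y.1 j - y.1 i) ^ 2) ^ 2) -
          partialQ j ((pinnedChain ω₂ lam β γ).hamiltonian L) y * (1 / (1 + 3 * β * (y.1 j - y.1 i) ^ 2))) +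
        y.2 j * (y.2 i ^ 2 * (-(6 * β * (y.1 j - y.1 i)) / (1 + 3 * β * (y.1 j - y.1 i) ^ 2) ^ 2) +
          partialQ i ((pinnedChain ω₂ lam β γ).hamiltonian L) y * (1 / (1 + 3 * β * (y.1 j - y.1 i) ^ 2))))
      else 0) x) ^ 2 ∂((pinnedChain ω₂ lam β γ).gibbsMeasure L T) ≤ c * ((L : ℝ) - 1) := by
  obtain ⟨CA, hCA0, hCA⟩ := exists_integral_sq_sum_fA_le hω hl hβ γ hT
  obtain ⟨CB, hCB0, hCB⟩ := exists_integral_sq_sum_fB_le hω hl hβ γ hT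
  refine ⟨3 * (4 * T ^ 2 + 2 * (CA + CB)), fun L hL => ?_⟩
  have h0L : (⟨0, by omega⟩ : Fin L) ≠ ⟨L - 1, by omega⟩ := fun h => by
    have := congrArg Fin.val h
    simp only at this
    omega
  have e0 := integral_sq_sub_sq_sq hω hl hβ γ hT L h0L
  have iA : Integrable (fun x : PhaseSpace L => (∑ i : Fin L, (∑ j : Fin L, if j.val = i.val + 1 then x.2 i * (x.2 j * (x.2 j ^ 2 * (6 * β * (9 * β * (x.1 j - x.1 i) ^ 2 - 1) / (1 + 3 * β * (x.1 j - x.1 i) ^ 2) ^ 3) - partialQ j (partialQ j ((pinnedChain ω₂ lam β γ).hamiltonian L)) x * (1 / (1 + 3 * β * (x.1 j - x.1 i) ^ 2)) - 3 * partialQ j ((pinnedChain ω₂ lam β γ).hamiltonian L) x * (-(6 * β * (x.1 j - x.1 i)) / (1 + 3 * β * (x.1 j - x.1 i) ^ 2) ^ 2)) + (∑ k : Fin L, if k.val = j.val + 1 then x.2 k * (1 + 3 * β * (x.1 k - x.1 j) ^ 2) else 0) * (1 / (1 + 3 * β * (x.1 j - x.1 i) ^ 2))) else 0)) ^ 2)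
      ((pinnedChain ω₂ lam β γ).gibbsMeasure L T) :=
    (memLp_finsetSum _ fun i _ => memLp_fA hω hl hβ γ hT L i).integrable_sq
  have iB : Integrable (fun x : PhaseSpace L => (∑ j : Fin L, (∑ i : Fin L, if j.val = i.val + 1 then x.2 j * (x.2 i * (-(x.2 i ^ 2 * (6 * β * (9 * β * (x.1 j - x.1 i) ^ 2 - 1) / (1 + 3 * β * (x.1 j - x.1 i) ^ 2) ^ 3)) + partialQ i (partialQ i ((pinnedChain ω₂ lam β γ).hamiltonian L)) x * (1 / (1 + 3 * β * (x.1 j - x.1 i) ^ 2)) - 3 * partialQ i ((pinnedChain ω₂ lam β γ).hamiltonian L) x * (-(6 * β * (x.1 j - x.1 i)) / (1 + 3 * β * (x.1 j - x.1 i) ^ 2) ^ 2)) - (∑ k : Fin L, if i.val = k.val + 1 then x.2 k * (1 + 3 * β * (x.1 i - x.1 k) ^ 2) else 0) * (1 / (1 + 3 * β * (x.1 j - x.1 i) ^ 2))) else 0)) ^ 2)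
      ((pinnedChain ω₂ lam β γ).gibbsMeasure L T) :=
    (memLp_finsetSum _ fun j _ => memLp_fB hω hl hβ γ hT L j).integrable_sq
  have i0 := (memLp_h0 hω hl hβ γ hT L ⟨0, by omega⟩ ⟨L - 1, by omega⟩).integrable_sq
  have hA := hCA L
  have hB := hCB L
  have hL1 : (1 : ℝ) ≤ (L : ℝ) - 1 := by
    have : (2 : ℝ) ≤ L := by exact_mod_cast hL
    linarith
  have hL2 : (L : ℝ) ≤ 2 * ((L : ℝ) - 1) := by linarith
  have hfun : (fun x : PhaseSpace L => ((pinnedChain ω₂ lam β γ).liouvillian L (fun y : PhaseSpace L => ∑ i : Fin L, ∑ j : Fin L, if j.val = i.val + 1 then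
      (y.2 i * (y.2 j ^ 2 * (-(6 * β * (y.1 j - y.1 i)) / (1 + 3 * β * (y.1 j - y.1 i) ^ 2) ^ 2) -
          partialQ j ((pinnedChain ω₂ lam β γ).hamiltonian L) y * (1 / (1 + 3 * β * (y.1 j - y.1 i) ^ 2))) +
        y.2 j * (y.2 i ^ 2 * (-(6 * β * (y.1 j - y.1 i)) / (1 + 3 * β * (y.1 j - y.1 i) ^ 2) ^ 2) +
          partialQ i ((pinnedChain ω₂ lam β γ).hamiltonian L) y * (1 / (1 + 3 * β * (y.1 j - y.1 i) ^ 2))))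
      else 0) x) ^ 2) = fun x =>
      ((x.2 ⟨0, by omega⟩ ^ 2 - x.2 ⟨L - 1, by omega⟩ ^ 2) +
        ((∑ i : Fin L, (∑ j : Fin L, if j.val = i.val + 1 then x.2 i * (x.2 j * (x.2 j ^ 2 * (6 * β * (9 * β * (x.1 j - x.1 i) ^ 2 - 1) / (1 + 3 * β * (x.1 j - x.1 i) ^ 2) ^ 3) - partialQ j (partialQ j ((pinnedChain ω₂ lam β γ).hamiltonian L)) x * (1 / (1 + 3 * β * (x.1 j - x.1 i) ^ 2)) - 3 * partialQ j ((pinnedChain ω₂ lam β γ).hamiltonian L) x * (-(6 * β * (x.1 j - x.1 i)) / (1 + 3 * β * (x.1 j - x.1 i) ^ 2) ^ 2)) + (∑ k : Fin L, if k.val = j.val + 1 then x.2 k * (1 + 3 * β * (x.1 k - x.1 j) ^ 2) else 0) * (1 / (1 + 3 * β * (x.1 j - x.1 i) ^ 2))) else 0)) +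
          ∑ j : Fin L, (∑ i : Fin L, if j.val = i.val + 1 then x.2 j * (x.2 i * (-(x.2 i ^ 2 * (6 * β * (9 * β * (x.1 j - x.1 i) ^ 2 - 1) / (1 + 3 * β * (x.1 j - x.1 i) ^ 2) ^ 3)) + partialQ i (partialQ i ((pinnedChain ω₂ lam β γ).hamiltonian L)) x * (1 / (1 + 3 * β * (x.1 j - x.1 i) ^ 2)) - 3 * partialQ i ((pinnedChain ω₂ lam β γ).hamiltonian L) x * (-(6 * β * (x.1 j - x.1 i)) / (1 + 3 * β * (x.1 j - x.1 i) ^ 2) ^ 2)) - (∑ k : Fin L, if i.val = k.val + 1 then x.2 k * (1 + 3 * β * (x.1 i - x.1 k) ^ 2) else 0) * (1 / (1 + 3 * β * (x.1 j - x.1 i) ^ 2))) else 0))) ^ 2 := by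
    funext x
    rw [liouvillian_thomsonWitness hβ hL x, sum_bond_split]
  rw [hfun]
  have hmono := integral_mono_of_nonneg (μ := ((pinnedChain ω₂ lam β γ).gibbsMeasure L T)) (ae_of_all _ fun x => sq_nonneg _)
    ((i0.fun_add (iA.fun_add iB)).const_mul 3) (ae_of_all _ fun x => add_add_sq_le
      (x.2 ⟨0, by omega⟩ ^ 2 - x.2 ⟨L - 1, by omega⟩ ^ 2)
      (∑ i : Fin L, (∑ j : Fin L, if j.val = i.val + 1 then x.2 i * (x.2 j * (x.2 j ^ 2 * (6 * β * (9 * β * (x.1 j - x.1 i) ^ 2 - 1) / (1 + 3 * β * (x.1 j - x.1 i) ^ 2) ^ 3) - partialQ j (partialQ j ((pinnedChain ω₂ lam β γ).hamiltonian L)) x * (1 / (1 + 3 * β * (x.1 j - x.1 i) ^ 2)) - 3 * partialQ j ((pinnedChain ω₂ lam β γ).hamiltonian L) x * (-(6 * β * (x.1 j - x.1 i)) / (1 + 3 * β * (x.1 j - x.1 i) ^ 2) ^ 2)) + (∑ k : Fin L, if k.val = j.val + 1 then x.2 k * (1 + 3 * β * (x.1 k - x.1 j) ^ 2) else 0) *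 (1 / (1 + 3 * β * (x.1 j - x.1 i) ^ 2))) else 0))
      (∑ j : Fin L, (∑ i : Fin L, if j.val = i.val + 1 then x.2 j * (x.2 i * (-(x.2 i ^ 2 * (6 * β * (9 * β * (x.1 j - x.1 i) ^ 2 - 1) / (1 + 3 * β * (x.1 j - x.1 i) ^ 2) ^ 3)) + partialQ i (partialQ i ((pinnedChain ω₂ lam β γ).hamiltonian L)) x * (1 / (1 + 3 * β * (x.1 j - x.1 i) ^ 2)) - 3 * partialQ i ((pinnedChain ω₂ lam β γ).hamiltonian L) x * (-(6 * β * (x.1 j - x.1 i)) / (1 + 3 * β * (x.1 j - x.1 i) ^ 2) ^ 2)) - (∑ k : Fin L, if i.val = k.val + 1 then x.2 k * (1 + 3 * β * (x.1 i - x.1 k) ^ 2) else 0) * (1 / (1 + 3 * β * (x.1 j - x.1 i) ^ 2))) else 0)))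
  refine hmono.trans ?_
  rw [integral_const_mul, integral_add i0 (iA.fun_add iB), integral_add iA iB, e0]
  have p1 := mul_le_mul_of_nonneg_left hL2 hCA0
  have p2 := mul_le_mul_of_nonneg_left hL2 hCB0
  have p3 := mul_le_mul_of_nonneg_left hL1 (by positivity : (0 : ℝ) ≤ 4 * T ^ 2)
  linarith

end Gibbs

/-! ### L4: registered wrapper -/

/-- Registered helper sub-goal `helper_thomsonWitnessCostsLiouvillian` of crux stmt-AtomisticToContinuum-11977 (line
`abel-storage-decay`, stub B `stub_bulkAbelGKPositivity`, part W5b): for the Thomson witness `v` of the pinned chain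
(`ω₂, lam, β, γ, T > 0`) there is `c` with, for every `L ≥ 2`, `X v ∈ L²(μ_T)`, `∫ (X v)² dμ_T ≤ c (L − 1)` and
`∫ (P₀ X v)² dμ_T = 4T²` — conjuncts 2, 7, 8 of the witness family of `bulkPositivity_of_witnessFamily`. [folklore] -/
theorem helper_thomsonWitnessCostsLiouvillian : ∀ (ω₂ lam β γ T : ℝ), 0 < ω₂ → 0 < lam → 0 < β → 0 < γ → 0 < T → ∃ c : ℝ, ∀ (L : ℕ), 2 ≤ L → let P := Literature.MathematicalPhysics.KineticTheory.HeatConduction.pinnedChain ω₂ lam β γ; let v : Literature.MathematicalPhysics.KineticTheory.HeatConduction.PhaseSpace L → ℝ := fun x => ∑ i : Fin L, ∑ j : Fin L, if j.val = i.val + 1 then (x.2 i * (x.2 j ^ 2 * (-(6 * β * (x.1 j - x.1 i)) / (1 + 3 * β * (x.1 j - x.1 i) ^ 2) ^ 2) - Literature.MathematicalPhysics.KineticTheory.HeatConduction.partialQ j (P.hamiltonian L) x * (1 / (1 + 3 * β * (x.1 j - x.1 i) ^ 2))) + x.2 j * (x.2 i ^ 2 * (-(6 * β * (x.1 j - x.1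 i)) / (1 + 3 * β * (x.1 j - x.1 i) ^ 2) ^ 2) + Literature.MathematicalPhysics.KineticTheory.HeatConduction.partialQ i (P.hamiltonian L) x * (1 / (1 + 3 * β * (x.1 j - x.1 i) ^ 2)))) else 0; MeasureTheory.MemLp (P.liouvillian L v) 2 (P.gibbsMeasure L T) ∧ MeasureTheory.integral (P.gibbsMeasure L T) (fun x => (P.liouvillian L v x) ^ 2) ≤ c * ((L : ℝ) - 1) ∧ MeasureTheory.integral (P.gibbsMeasure L T) (fun x => ((∑ σ : Fin L → Bool, P.liouvillian L v (x.1, fun i => if σ i then -x.2 i else x.2 i)) / 2 ^ L) ^ 2) = 4 * T ^ 2 := by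
  intro ω₂ lam β γ T hω hl hβ _hγ hT
  obtain ⟨c, hc⟩ := exists_integral_sq_liouvillian_thomsonWitness_le hω hl.le hβ.le γ hT
  refine ⟨c, fun L hL => ?_⟩
  intro P v
  exact ⟨memLp_liouvillian_thomsonWitness hω hl.le hβ.le γ hT hL, hc L hL,
    integral_sq_patternAvg_liouvillian_thomsonWitness hω hl.le hβ.le γ hT hL⟩

end Summit.AtomisticToContinuum.FouriersLaw.Theorems.NoisyFourier.ThomsonWitness.Costs

end
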